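import Mathlib.Analysis.Calculus.Deriv.MeanValue
import Literature.Geometry.Lorentzian.KerrSeparatedPotential
import Literature.Geometry.Lorentzian.KerrSeparatedPotentialBounds
import Literature.Geometry.Lorentzian.KerrSurfaceGravity
import Literature.Geometry.Lorentzian.KerrSeparatedPotentialConeLevel
import HarnessLib

/-!
# No well in the threshold cone for the FULL Carter potential: the classically forbidden set
# `{r > r₊ : ω² ≤ V(r)}` is an interval (stub `stub_fullConeCensus`, line `olver-dunster-uniform-reduction`)

Crux `PhaseMixingCapture.KappaExplicitWaveDecay` (stmt-FinalStateConjecture-10654), line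
`olver-dunster-uniform-reduction`. `V = Kerr.sepPotential M a ω m Λ = V₀ + V₁` is the potential of
Carter's radial ODE `u″ + (ω² − V)u = 0` (DRSR arXiv:1402.7034, §6.2). **Statement**
(`stub_fullConeCensus`): for every `M > 0` there are `a₁ < M`, `ε₀ > 0` (here `a₁ = 0.999·M`,
`ε₀ = 1/(50M)`) such that for `a₁ ≤ |a| < M`, `m ≠ 0` and `|ω − mω₊| ≤ ε₀|m|` the set
`{r > r₊ : ω² ≤ V(r)}` is order-connected — ONE barrier (possibly empty), no well — uniformly in
the two unbounded parameters `m` and `Λ` (the admissibility of `(ω, m, Λ)` is not even needed). It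
is the first hypothesis of the flux-regime kernel bound `stub_fluxRegimeCorePoly`. The
principal-part version (`V₀` only) is `stub_coneCensus` (`…ConeCensus.lean`); `V₁ ≥ 0` changes the
forbidden set at order one for `m = ±1`, so this is not a corollary of it.

## Proof

Dimensionless variables `g = (r₊ − M)/M = √(M² − a²)/M ∈ [0, 1/20]`,
`s = (2Mr₊ω − am)/(am) = 2Mr₊(ω − mω₊)/(am)`, `|s| ≤ 1/10`, `c = 1/m² ∈ (0, 1]`,
`ℓ = (Λ − 2amω)/m²`, `x = (r − r₊)/M > 0`. From the printed potential (`Kerr.sepPotential_eq`) one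
gets the rational-function identity `level_identity` (`field_simp; ring`, with `α = a²/M²` kept as
a literal subterm), and with `r₊² + a² = 2Mr₊`, i.e. `α = 1 − g²`,
`4(1+g)²(r² + a²)⁴(ω² − V(r)) = M⁶ m² (1+g) (Â(x) − ℓ·B̂(x))`,
`Â = (1−g)u²((1+s)u − 2(1+g))² − 4(1+g)c·x(x+2g)·((1−g²)x(x+2g) + 2(1+g+x)((1+g+x)² − 1 + g²))`,
`B̂ = 4(1+g)·x(x+2g)·u² > 0`, `u = x² + 2(1+g)x + 2(1+g)`. So the forbidden set is the sublevel
set `{F ≤ ℓ}`, `F = Â/B̂`, of ONE function of `x > 0`, and `F` has no interior strict maximum on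
`(0, ∞)` for all box parameters (`Kerr.coneLevel_quasiconvex`,
`Literature/Geometry/Lorentzian/KerrSeparatedPotentialConeLevel.lean`, resting on the coefficient
sign table of `KerrSeparatedPotentialConeLevelTables.lean`): if `r₁ < r₂ < r₃` with `r₁, r₃`
forbidden then `F(x₂) ≤ max(F(x₁), F(x₃)) ≤ ℓ`, i.e. `r₂` is forbidden. The choice `a₁ = 0.999M`
gives `g ≤ 1/20` (`400(M² − a²) ≤ M²`), and `ε₀ = 1/(50M)` gives
`|s| = 2Mr₊|ω − mω₊|/(|a||m|) ≤ (4M²/(50M))/(0.999M)·… ≤ 1/10`. Real algebra; no named fact is used.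
-/

-- the doubled `FinalStateConjecture.FinalStateConjecture` path component trips dupNamespace
set_option linter.dupNamespace false

noncomputable section

namespace Summit.FinalStateConjecture.FinalStateConjecture.Theorems.KappaExplicitWaveDecay.OlverDunsterUniformReduction

open Literature.Geometry.Lorentzian
open Set

set_option maxRecDepth 8192 in
set_option maxHeartbeats 1500000 in
/-- **The level identity.** With `r = M(1+g) + Mx`, `ω = am(1+s)/(2M·M(1+g))`,
`Λ = m²ℓ + 2amω` and `α = a²/M²` (kept as the literal subterm `a ^ 2 / M ^ 2`):
`4(1+g)²(r² + a²)⁴(ω² − V(r)) = M⁶ m² (Ā_α(x) − ℓ·B̄_α(x))`, a rational-function identity obtained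
from `Kerr.sepPotential_eq` by clearing denominators. -/
private theorem level_identity {M a ω Λ r s ℓ g x : ℝ} {m : ℤ} (hM : M ≠ 0) (ha : a ≠ 0)
    (hm : (m : ℝ) ≠ 0) (hg : 1 + g ≠ 0) (hr : r = M * (1 + g) + M * x)
    (hω : ω = a * m * (1 + s) / (2 * M * (M * (1 + g))))
    (hΛ : Λ = (m : ℝ) ^ 2 * ℓ + 2 * a * m * ω) :
    4 * (1 + g) ^ 2 * (r ^ 2 + a ^ 2) ^ 4 * (ω ^ 2 - Kerr.sepPotential M a ω m Λ r) =
      M ^ 6 * (m : ℝ) ^ 2 *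
        ((a ^ 2 / M ^ 2) * ((1 + g + x) ^ 2 + a ^ 2 / M ^ 2) ^ 2 *
            ((1 + s) * ((1 + g + x) ^ 2 + a ^ 2 / M ^ 2) - 2 * (1 + g)) ^ 2 -
          4 * (1 + g) ^ 2 * (1 / (m : ℝ) ^ 2) * ((1 + g + x) ^ 2 - 2 * (1 + g + x) + a ^ 2 / M ^ 2) *
            ((a ^ 2 / M ^ 2) * ((1 + g + x) ^ 2 - 2 * (1 + g + x) + a ^ 2 / M ^ 2) +
              2 * (1 + g + x) * ((1 + g + x) ^ 2 - a ^ 2 / M ^ 2)) -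
          ℓ * (4 * (1 + g) ^ 2 * ((1 + g + x) ^ 2 - 2 * (1 + g + x) + a ^ 2 / M ^ 2) *
            ((1 + g + x) ^ 2 + a ^ 2 / M ^ 2) ^ 2)) := by
  subst hΛ
  subst hω
  subst hr
  rw [Kerr.sepPotential_eq]
  have hra : (M * (1 + g) + M * x) ^ 2 + a ^ 2 ≠ 0 := by positivity
  field_simp
  ring

set_option maxRecDepth 8192 in
set_option maxHeartbeats 400000 in
/-- **S5a-F-census · `stub_fullConeCensus` — NO WELL for the full potential in the threshold
cone.** For every `M > 0` there are `a₁ < M` and `ε₀ > 0` (here `a₁ = 0.999·M`,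
`ε₀ = 1/(50M)`) such that for all `a₁ ≤ |a| < M`, all admissible `(ω, m, Λ)` with `m ≠ 0` in the
cone `|ω − mω₊| ≤ ε₀|m|`, the classically forbidden set `{r > r₊ : ω² ≤ V(r)}` of Carter's
potential `V = Kerr.sepPotential M a ω m Λ` is order-connected (one interval, possibly empty). -/
theorem stub_fullConeCensus :
    (∀ M : ℝ, 0 < M → ∃ a₁ ε₀ : ℝ, a₁ < M ∧ 0 < ε₀ ∧
      ∀ a : ℝ, a₁ ≤ |a| → Kerr.IsSubextremal M a →
        ∀ (ω : ℝ) (m : ℤ) (Λ : ℝ), Kerr.IsAdmissibleTriple a ω m Λ → m ≠ 0 →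
          |ω - m * Kerr.horizonAngularVelocity M a| ≤ ε₀ * |(m : ℝ)| →
            (Ioi (Kerr.rPlus M a) ∩ {r : ℝ | ω ^ 2 ≤ Kerr.sepPotential M a ω m Λ r}).OrdConnected) := by
  intro M hM
  refine ⟨999 / 1000 * M, 1 / (50 * M), by linarith, by positivity, ?_⟩
  intro a ha hsub ω m Λ _ hm hcone
  -- basic quantities
  set rp := Kerr.rPlus M a with hrp_def
  have haM : |a| ≤ M := le_of_lt hsub
  have ha0 : 0 < |a| := lt_of_lt_of_le (by positivity) ha
  have hane : a ≠ 0 := abs_pos.1 ha0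
  have hmR : (m : ℝ) ≠ 0 := Int.cast_ne_zero.2 hm
  have hmabs : 0 < |(m : ℝ)| := abs_pos.2 hmR
  have hrp_pos : 0 < rp := Kerr.rPlus_pos hM a
  have hMrp : M ≤ rp := Kerr.M_le_rPlus M a
  have hrp2M : rp ≤ 2 * M := Kerr.rPlus_le_two_mul_self hM.le a
  have hA : rp ^ 2 + a ^ 2 = 2 * M * rp := Kerr.rPlus_sq_add_sq haM
  -- dimensionless parameters
  set g := rp / M - 1 with hg_def
  set s := 2 * M * rp * ω / (a * m) - 1 with hs_def
  set c := 1 / (m : ℝ) ^ 2 with hc_def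
  set ℓ := (Λ - 2 * a * m * ω) / (m : ℝ) ^ 2 with hl_def
  have hrp_eq : rp = M * (1 + g) := by rw [hg_def]; field_simp; ring
  have hg0 : 0 ≤ g := by
    rw [hg_def, sub_nonneg, le_div_iff₀ hM, one_mul]; exact hMrp
  have hg1' : 0 < 1 + g := by linarith
  have hω : ω = a * m * (1 + s) / (2 * M * (M * (1 + g))) := by
    rw [← hrp_eq, hs_def]; field_simp; ring
  have hΛ : Λ = (m : ℝ) ^ 2 * ℓ + 2 * a * m * ω := by rw [hl_def]; field_simp; ring
  have hα : a ^ 2 / M ^ 2 = 1 - g ^ 2 := by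
    rw [hg_def]
    field_simp
    linear_combination hA
  -- the box: `20 g ≤ 1`
  have hg1 : 20 * g ≤ 1 := by
    have hsq : rp - M = √(M ^ 2 - a ^ 2) := Kerr.rPlus_sub_self M a
    have ha2 : (999 / 1000 * M) ^ 2 ≤ a ^ 2 := by
      have h0 : 0 ≤ 999 / 1000 * M := by positivity
      calc (999 / 1000 * M) ^ 2 ≤ |a| ^ 2 := pow_le_pow_left₀ h0 ha 2
        _ = a ^ 2 := sq_abs a
    have hroot : √(M ^ 2 - a ^ 2) ≤ M / 20 := by
      rw [Real.sqrt_le_left (by positivity)]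
      nlinarith
    have eg : g = (rp - M) / M := by rw [hg_def]; field_simp
    rw [eg, hsq, ← le_div_iff₀' (by norm_num : (0 : ℝ) < 20), div_le_iff₀ hM]
    linarith
  -- the box: `10 |s| ≤ 1`
  have hs : 10 * |s| ≤ 1 := by
    have es : s = 2 * M * rp * (ω - m * Kerr.horizonAngularVelocity M a) / (a * m) := by
      rw [hs_def]
      unfold Kerr.horizonAngularVelocity
      rw [← hrp_def]
      field_simp
    have hnum : |2 * M * rp * (ω - m * Kerr.horizonAngularVelocity M a)| =
        2 * M * rp * |ω - m * Kerr.horizonAngularVelocity M a| := by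
      rw [abs_mul (2 * M * rp), abs_of_pos (by positivity : (0 : ℝ) < 2 * M * rp)]
    have hden : |a * (m : ℝ)| = |a| * |(m : ℝ)| := abs_mul a m
    have hden_pos : 0 < |a| * |(m : ℝ)| := mul_pos ha0 hmabs
    rw [es, abs_div, hnum, hden, ← mul_div_assoc, div_le_one hden_pos]
    calc 10 * (2 * M * rp * |ω - m * Kerr.horizonAngularVelocity M a|)
          ≤ 10 * (2 * M * rp * (1 / (50 * M) * |(m : ℝ)|)) := by gcongr
      _ = 2 / 5 * rp * |(m : ℝ)| := by field_simp; ring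
      _ ≤ |a| * |(m : ℝ)| := by
          apply mul_le_mul_of_nonneg_right _ hmabs.le
          linarith
  have hc0 : 0 ≤ c := by positivity
  have hc1 : c ≤ 1 := by
    rw [hc_def, div_le_one (by positivity)]
    have h1 : (1 : ℝ) ≤ |(m : ℝ)| := by exact_mod_cast Int.one_le_abs hm
    nlinarith [sq_abs (m : ℝ)]
  -- the level function `F = Â/B̂`
  set F : ℝ → ℝ := fun t ↦
    ((1 - g) * (t ^ 2 + 2 * (1 + g) * t + 2 * (1 + g)) ^ 2 *
          ((1 + s) * (t ^ 2 + 2 * (1 + g) * t + 2 * (1 + g)) - 2 * (1 + g)) ^ 2 -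
        4 * (1 + g) * c * (t * (t + 2 * g)) *
          ((1 - g ^ 2) * (t * (t + 2 * g)) + 2 * (1 + g + t) * ((1 + g + t) ^ 2 - (1 - g ^ 2)))) /
      (4 * (1 + g) * (t * (t + 2 * g)) * (t ^ 2 + 2 * (1 + g) * t + 2 * (1 + g)) ^ 2) with hF
  -- the forbidden set is the sublevel set `{F ≤ ℓ}`
  have key : ∀ r, rp < r →
      (ω ^ 2 ≤ Kerr.sepPotential M a ω m Λ r ↔ F ((r - rp) / M) ≤ ℓ) := by
    intro r hr
    set x := (r - rp) / M with hx_def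
    have hx : 0 < x := div_pos (sub_pos.2 hr) hM
    have hr_eq : r = M * (1 + g) + M * x := by rw [hx_def, ← hrp_eq]; field_simp; ring
    have hid := level_identity (s := s) (ℓ := ℓ) hM.ne' hane hmR hg1'.ne' hr_eq hω hΛ
    rw [hα] at hid
    have hFx : F x = ((1 - g) * (x ^ 2 + 2 * (1 + g) * x + 2 * (1 + g)) ^ 2 *
          ((1 + s) * (x ^ 2 + 2 * (1 + g) * x + 2 * (1 + g)) - 2 * (1 + g)) ^ 2 -
        4 * (1 + g) * c * (x * (x + 2 * g)) *
          ((1 - g ^ 2) * (x * (x + 2 * g)) + 2 * (1 + g + x) * ((1 + g + x) ^ 2 - (1 - g ^ 2)))) /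
        (4 * (1 + g) * (x * (x + 2 * g)) * (x ^ 2 + 2 * (1 + g) * x + 2 * (1 + g)) ^ 2) := rfl
    rw [hFx]
    -- `Â(x)`, `B̂(x)` as atoms
    set Ax := (1 - g) * (x ^ 2 + 2 * (1 + g) * x + 2 * (1 + g)) ^ 2 *
          ((1 + s) * (x ^ 2 + 2 * (1 + g) * x + 2 * (1 + g)) - 2 * (1 + g)) ^ 2 -
        4 * (1 + g) * c * (x * (x + 2 * g)) *
          ((1 - g ^ 2) * (x * (x + 2 * g)) + 2 * (1 + g + x) * ((1 + g + x) ^ 2 - (1 - g ^ 2))) with hAx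
    set Bx := 4 * (1 + g) * (x * (x + 2 * g)) * (x ^ 2 + 2 * (1 + g) * x + 2 * (1 + g)) ^ 2 with hBx
    have hB : 0 < Bx := by rw [hBx]; positivity
    have hid' : 4 * (1 + g) ^ 2 * (r ^ 2 + a ^ 2) ^ 4 *
        (ω ^ 2 - Kerr.sepPotential M a ω m Λ r) =
        M ^ 6 * (m : ℝ) ^ 2 * (1 + g) * (Ax - ℓ * Bx) := by
      rw [hid, ← hc_def, hAx, hBx]; ring
    have hpos1 : 0 < 4 * (1 + g) ^ 2 * (r ^ 2 + a ^ 2) ^ 4 := by positivity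
    have hpos2 : 0 < M ^ 6 * (m : ℝ) ^ 2 * (1 + g) := by positivity
    rw [div_le_iff₀ hB]
    constructor
    · intro h
      have h2 : 4 * (1 + g) ^ 2 * (r ^ 2 + a ^ 2) ^ 4 *
          (ω ^ 2 - Kerr.sepPotential M a ω m Λ r) ≤ 0 :=
        mul_nonpos_of_nonneg_of_nonpos hpos1.le (sub_nonpos.2 h)
      rw [hid'] at h2
      by_contra h4
      push Not at h4
      have h5 : 0 < Ax - ℓ * Bx := sub_pos.2 h4
      linarith [mul_pos hpos2 h5]
    · intro h
      have h2 : M ^ 6 * (m : ℝ) ^ 2 * (1 + g) * (Ax - ℓ * Bx) ≤ 0 :=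
        mul_nonpos_of_nonneg_of_nonpos hpos2.le (sub_nonpos.2 h)
      rw [← hid'] at h2
      by_contra h4
      push Not at h4
      have h5 : 0 < ω ^ 2 - Kerr.sepPotential M a ω m Λ r := sub_pos.2 h4
      linarith [mul_pos hpos1 h5]
  -- order-connectedness
  rw [ordConnected_iff]
  rintro r₁ ⟨hr₁, hV₁⟩ r₃ ⟨hr₃, hV₃⟩ _ r₂ ⟨h12, h23⟩
  simp only [mem_inter_iff, mem_Ioi, mem_setOf_eq] at hr₁ hr₃ hV₁ hV₃ ⊢
  have hr₂ : rp < r₂ := hr₁.trans_le h12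
  refine ⟨hr₂, ?_⟩
  rcases eq_or_lt_of_le h12 with e12 | h12'
  · rw [← e12]; exact hV₁
  rcases eq_or_lt_of_le h23 with e23 | h23'
  · rw [e23]; exact hV₃
  rw [key r₁ hr₁] at hV₁
  rw [key r₃ hr₃] at hV₃
  rw [key r₂ hr₂]
  have hx : 0 < (r₁ - rp) / M := div_pos (sub_pos.2 hr₁) hM
  have hxy : (r₁ - rp) / M < (r₂ - rp) / M := by
    apply div_lt_div_of_pos_right _ hM; linarith
  have hyz : (r₂ - rp) / M < (r₃ - rp) / M := by
    apply div_lt_div_of_pos_right _ hM; linarith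
  exact (Kerr.coneLevel_quasiconvex hg0 hg1 hs hc0 hc1 F (fun t ↦ rfl) hx hxy hyz).trans
    (max_le hV₁ hV₃)

end Summit.FinalStateConjecture.FinalStateConjecture.Theorems.KappaExplicitWaveDecay.OlverDunsterUniformReduction
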